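import Mathlib
import Literature.NumberTheory.DiophantineGeometry.Conductor
import Literature.NumberTheory.DiophantineGeometry.MinimalDiscriminant

/-!
# Sketch — crux-ideate stmt-ABC-1561 (ManyPrimeValuationProduct), ideator 3, round 1

First-lemma signatures for the two idea cards
* `Ideas/unramified-window-census.md`  (namespace `WindowCensus`)
* `Ideas/toric-character-slope-gcd.md` (namespace `SlopeGcd`)
Nothing here is a route item; these are the first checkable statements of each line.
-/

namespace Summit.ABC.ABC.Cruxes.ManyPrimeValuationProduct.Sketch

open scoped BigOperators
open Finset

/-! ## Card `unramified-window-census` -/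
namespace WindowCensus

/-- The multiplicative valuation product `T(E) = ∏_{p ∣ N, p² ∤ N} ord_p Δ_min` of the crux,
verbatim the route's inline product. -/
noncomputable def valProd (W : WeierstrassCurve ℚ) : ℕ :=
  ∏ p ∈ (W.conductorNorm ℤ).primeFactors with ¬ p ^ 2 ∣ W.conductorNorm ℤ,
    (W.minimalDiscriminantNorm ℤ).factorization p

/-- `U_E(q)` for a prime power `q = ℓ^k`: the multiplicative primes `p` of `E` with `q ∣ ord_p Δ_min`
(Tate: exactly the multiplicative primes at which `E[ℓ^k]` is unramified, `p ≠ ℓ`). -/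
noncomputable def unramSet (W : WeierstrassCurve ℚ) (q : ℕ) : Finset ℕ :=
  ((W.conductorNorm ℤ).primeFactors.filter fun p => ¬ p ^ 2 ∣ W.conductorNorm ℤ).filter
    fun p => q ∣ (W.minimalDiscriminantNorm ℤ).factorization p

/-- The windowed census `S_L(E) = Σ_{q prime power, q > L} #U_E(q) · log (q.minFac)`; the sum is
finite because `U_E(q) = ∅` once `q` exceeds every exponent (we cut at `valProd W`, which bounds
each exponent since every factor of the product is `≥ 1`). -/
noncomputable def census (W : WeierstrassCurve ℚ) (L : ℕ) : ℝ :=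
  ∑ q ∈ (Finset.Icc (L + 1) (valProd W)).filter IsPrimePow,
    ((unramSet W q).card : ℝ) * Real.log q.minFac

/-- **First lemma (elementary anatomy identity, provable now).** For a positive natural `v`,
`log v = Σ_{prime powers q ∣ v} log (q.minFac)`; summed over the multiplicative primes this is
`log T(E) = Σ_q #U_E(q) log ℓ(q)`, i.e. `log T(E) = census W 0`. Stated in the abstract form the
prover needs first. -/
theorem log_eq_sum_primePow_dvd (v : ℕ) (hv : 0 < v) :
    Real.log v = ∑ q ∈ (Finset.Icc 1 v).filter (fun q => IsPrimePow q ∧ q ∣ v),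
      Real.log q.minFac := by
  sorry

/-- **Window lemma (provable now).** Prime powers `q ≤ L` contribute at most `ω · θ'(L)` where
`θ'(L) = Σ_{prime powers q ≤ L} log ℓ(q) ≤ 1.04 L`; with `ω ≤ (1+o(1)) log N / log log N` and
`L = ε log log N` this is `≤ 1.1 ε log N`: small prime powers are FREE. Abstract form: -/
theorem sum_log_le_window (ω L : ℕ) (v : Fin ω → ℕ) (hv : ∀ i, 0 < v i) :
    ∑ i, Real.log (v i) ≤
      ω * (∑ q ∈ (Finset.Icc 1 L).filter IsPrimePow, Real.log q.minFac) +
      ∑ i, ∑ q ∈ (Finset.Icc (L + 1) (v i)).filter (fun q => IsPrimePow q ∧ q ∣ v i),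
        Real.log q.minFac := by
  sorry

/-- **The transferred crux C⁺ = `WindowedCensusBound`**: for every `ε > 0` there is `C` such that
for every `E/ℚ` semistable away from `2` with `≥ 4` odd multiplicative primes,
`S_{⌊ε log log N⌋}(E) ≤ ε log N + C`.  Claim of the card: `WindowedCensusBound ↔ crux`
(elementary given `ω(N) ≤ 1.1 log N/ log log N` for `N ≥ N₀`), and by Pasten's unconditional
`T(E) < K_ε N^{11/2+ε}` the census window is `(ε log log N, K N^6]`. -/
def WindowedCensusBound : Prop :=
  ∀ ε : ℝ, 0 < ε → ∃ C : ℝ, ∀ (W : WeierstrassCurve ℚ) [W.IsElliptic],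
    (∀ p : ℕ, p.Prime → p ≠ 2 → ¬ p ^ 2 ∣ W.conductorNorm ℤ) →
    4 ≤ ((W.conductorNorm ℤ).primeFactors.filter
      (fun p => p ≠ 2 ∧ ¬ p ^ 2 ∣ W.conductorNorm ℤ)).card →
    census W ⌊ε * Real.log (Real.log (W.conductorNorm ℤ))⌋₊ ≤
      ε * Real.log (W.conductorNorm ℤ) + C

/-- The crux, verbatim (local copy so that this sketch does not import the route module). -/
def Crux : Prop :=
  ∀ ε : ℝ, 0 < ε → ∃ C : ℝ, ∀ (W : WeierstrassCurve ℚ) [W.IsElliptic],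
    (∀ p : ℕ, p.Prime → p ≠ 2 → ¬ p ^ 2 ∣ W.conductorNorm ℤ) →
    4 ≤ ((W.conductorNorm ℤ).primeFactors.filter
      (fun p => p ≠ 2 ∧ ¬ p ^ 2 ∣ W.conductorNorm ℤ)).card →
    ((∏ p ∈ (W.conductorNorm ℤ).primeFactors with ¬ p ^ 2 ∣ W.conductorNorm ℤ,
      (W.minimalDiscriminantNorm ℤ).factorization p : ℕ) : ℝ) ≤ C * (W.conductorNorm ℤ : ℝ) ^ ε

/-- **Transfer statement** (the card's K1, provable now modulo the primorial bound
`ω(N) ≤ (1+o(1)) log N / log log N`, Mathlib-adjacent): the windowed census decides the crux. -/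
theorem crux_iff_windowedCensusBound : Crux ↔ WindowedCensusBound := by
  sorry

end WindowCensus

/-! ## Card `toric-character-slope-gcd` -/
namespace SlopeGcd

/-- **First lemma (combinatorial shell of the p-adic Zagier formula).**
Data at a multiplicative prime `p` of the optimal curve: supersingular points `s : Fin n` of
`X₀(N/p)_{𝔽_p}` with thicknesses `w s ∈ {1,2,3}`, the signed winding numbers `d s ∈ ℤ` of the
modular parametrisation on the supersingular annuli (possibly `0`: 37a1 at 37 has `d = (1,-1,0)`),
the cycle length `c = ord_p Δ_min`, and an offset `δ₀`.  Degree zero gives `Σ d_s = 0`; for the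
winding annuli `w_s d_s ≡ δ₀ (mod c)` (and `d_s = 0` forces `δ₀ = 0`, the two vertices landing in
the same residue class).  CONSEQUENCE: `c ∣ Σ_s w_s d_s²` — the integer `(Σ w_s d_s²)/c` is `deg φ`
(`c_p · deg φ = ⟨φ^*χ_E, φ^*χ_E⟩_monodromy`, Grothendieck SGA7 IX + Ribet–Takahashi Prop. 1;
checks: 11a1 `5·1 = 2+3`, 37a1 `1·2 = 1+1+0`, 37b1 `3·2 = 1+1+4`). -/
theorem cycle_dvd_weighted_slope_energy (n c : ℕ) (w : Fin n → ℕ) (d : Fin n → ℤ)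
    (δ₀ : ZMod c) (hcong : ∀ s, (((w s : ℤ) * d s : ℤ) : ZMod c) = δ₀)
    (hsum : ∑ s, d s = 0) :
    (c : ℤ) ∣ ∑ s, (w s : ℤ) * d s ^ 2 := by
  sorry

/-- **Second statement of the line (Edixhoven 1991 ⇒ slope divisibility; to be proved from the
named facts).** If a prime power `q = ℓ^k` with `ℓ > 163` divides `c` exactly-enough and the
Hecke action on `Φ_p(J₀(N))` is Eisenstein while `ρ̄_{E,ℓ}` is irreducible, then `q ∣ d s` for
every `s`; abstractly: if `q ∣ c`, `q ∣ δ₀`-lift and `gcd(q, w s) = 1` then `q ∣ d s`.  The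
dichotomy `q ∣ δ₀ ∨ Eisenstein mod q` is the content; here only the arithmetic shell. -/
theorem slope_dvd_of_offset_dvd (n c q : ℕ) (hqc : q ∣ c) (w : Fin n → ℕ) (d : Fin n → ℤ)
    (δ : ℤ) (hδ : (q : ℤ) ∣ δ) (hcong : ∀ s, (c : ℤ) ∣ (w s : ℤ) * d s - δ)
    (hw : ∀ s, Nat.Coprime q (w s)) : ∀ s, (q : ℤ) ∣ d s := by
  sorry

/-- **Necessary inequality exported by the line:** restricting to the SUPPORT of the winding
vector (the `s` with `d s ≠ 0`, at least two of them), with all winding numbers divisible by `g`: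
`c · deg φ = Σ w_s d_s² ≥ g² Σ_{s ∈ supp} w_s ≥ 2 g²`; with a delocalisation input
`Σ_{supp} w_s ≥ #SS_p^θ` this is the support form (b) of the card. -/
theorem degree_lower_bound (n c g D : ℕ) (w : Fin n → ℕ) (d : Fin n → ℤ)
    (hdeg : (c : ℤ) * D = ∑ s, (w s : ℤ) * d s ^ 2) (hg : ∀ s, (g : ℤ) ∣ d s)
    (hne : ∀ s, d s ≠ 0) : (g : ℤ) ^ 2 * ∑ s, (w s : ℤ) ≤ (c : ℤ) * D := by
  sorry

end SlopeGcd

end Summit.ABC.ABC.Cruxes.ManyPrimeValuationProduct.Sketch
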